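import Literature.AnabelianGeometry.EtaleTheta.Discharge.Sec3Prop34iConnectedOfGaloisCovering
import Literature.AnabelianGeometry.EtaleTheta.Discharge.Sec3RlfEffectiveWeak
import Literature.AnabelianGeometry.EtaleTheta.RealifiedDivisorMonoidsOfRlfWeak

/-!
# [EtTh] Def. 3.6 (i) at the constructed Def. 3.3 (iii) data: the realified data of monoid type `ℤ` over the
# connected coverings dominated by one universal combinatorial covering, with `hFinv` and `hP34Λ` as THEOREMS

S. Mochizuki, *The étale theta function …*, Publ. RIMS **45** (2009) [MochizukiEtTh2009], §3, Def. 3.6 (i), PRIMS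
PDF p.76 (printed 302): "write `Φ₀^ℝ := Φ₀^rlf` …; `B₀^Λ` for `B₀` (resp. `B₀^pf`; `ℝ·Φ₀^birat`) if `Λ = ℤ` (resp.
`ℚ`; `ℝ`), `F₀^Λ ⊆ B₀^Λ` for `F₀` (resp. …)"; Prop. 3.4 (ii), p.74 [cite: MochizukiEtTh2009, Def 3.6 p.76].

PROOF-ONLY companion (abc-iut cell, W6 seat d058, EtTh:Prop3.4 chain; 0 defs).  With Prop. 3.4 (i)+(ii) a
THEOREM at the Def. 3.3 (iii) data of the connected coverings (`DivisorMonoids.prop34_ofGaloisActionConnected`,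
`Discharge/Sec3Prop34iConnectedOfGaloisCovering.lean`), abc-iut-L2-d2's weak Def. 3.6 (i) constructor
`RealifiedDivisorMonoids.ofRlfZWeakOfProp34` (`RealifiedDivisorMonoidsOfRlfWeak.lean`; every Def. 3.6 (i) axiom
proved there) APPLIES, giving the realified data of monoid type `ℤ`
`T := ofRlfZWeakOfProp34 (ofGaloisActionConnected A hZ) (prop34_ofGaloisActionConnected A hZ R R')`
(`Φ₀^ℝ = Φ₀^rlf`, `B₀^ℤ = B₀ = Hom_G(−, Mero(Z^log_∞))`, `F₀^ℤ = F₀ = Hom_G(−, L^×)`) — no hypothesis left.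
Recorded here, for this `T`:
* `rlfZ_ofGaloisActionConnected_toDivisorMonoids` / `_Λ` — it sits over the constructed data, type `ℤ`;
* **`hFinv_rlfZ_ofGaloisActionConnected`** — the binder `hFinv` of GAP row G-w5d135-1 ("`F₀^Λ(Y)` is closed
  under inverses", Prop. 3.4 (ii) iso 3: `L^×` is a group) is a THEOREM at this data;
* **`hP34Λ_rlfZ_ofGaloisActionConnected`** — the binder `hP34Λ` of GAP row G-w5d124-1 = the typed field
  `RealifiedDivisorMonoids.Prop34Cnst.mem_FΛ_of_divΛ_eq_of` ("an element of `B₀^Λ(Y)` whose image in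
  `(Φ₀^ℝ)^gp(Y)` is effective is constant", Prop. 3.4 (ii) isos 1–2 at the `Λ`-level) is a THEOREM at this
  data: effectivity in `(Φ₀^rlf)^gp` is detected in `Φ₀` (abc-iut-L2-d2's `RlfEffective.exists_eq_of_weak`)
  and then Prop. 3.4 (ii) iso 2 (`GaloisAction.mem_fZero_of_divZeroHom_eq_of`, from Prop. 3.2 (ii)) applies;
* `ker_divΛ_rlfZ_ofGaloisActionConnected` — likewise "trivial `Λ`-divisor ⇒ unit constant".
The `D^cnst`-naturality clauses of `Prop34Cnst` (constant-field functor) are not treated here.  HONEST FRAMING: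
theorems about a construction over typed interfaces (one term of Def. 3.3 (iii)'s limit; binder `hZ` =
G-w6d058-1); nothing here bears on [IUTchIII] Cor. 3.12; no side taken; typed ≠ proved for anything else.
-/

noncomputable section

namespace Literature.AnabelianGeometry.EtaleTheta

open CategoryTheory Opposite Literature.AlgebraicGeometry.Frobenioids

universe u

namespace DivisorMonoids

open LogDivisorModel.GaloisAction

variable {Z : LogDivisorModel.{u}} {G : Type u} [Group G] (A : Z.GaloisAction G) (hZ : Z.CuspLaws)
  (R R' : ((isConnectedGSet (G := G)).FullSubcategoryᵒᵖ ⥤ CommMonCat.{u}) → Prop)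

/-- The Def. 3.6 (i) data of type `ℤ` obtained from the constructed Def. 3.3 (iii) data sit over those data.
[cite: MochizukiEtTh2009, Def 3.6 p.76] -/
theorem rlfZ_ofGaloisActionConnected_toDivisorMonoids :
    (RealifiedDivisorMonoids.ofRlfZWeakOfProp34 (ofGaloisActionConnected A hZ)
        (prop34_ofGaloisActionConnected A hZ R R')).toDivisorMonoids = ofGaloisActionConnected A hZ := rfl

/-- … and have monoid type `Λ = ℤ`. [cite: MochizukiEtTh2009, Def 3.6 p.76] -/
theorem rlfZ_ofGaloisActionConnected_Λ :
    (RealifiedDivisorMonoids.ofRlfZWeakOfProp34 (ofGaloisActionConnected A hZ)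
        (prop34_ofGaloisActionConnected A hZ R R')).Λ = MonoidType.Z := rfl

/-- **`hFinv` (GAP G-w5d135-1) is a THEOREM at this data**: `F₀^ℤ(Y) = F₀(Y) = Hom_G(Y, L^×)` is closed under
inverses (Prop. 3.4 (ii) iso 3). [cite: MochizukiEtTh2009, Prop 3.4 p.74] -/
theorem hFinv_rlfZ_ofGaloisActionConnected (Y : ((isConnectedGSet (G := G)).FullSubcategory)ᵒᵖ)
    (b : (RealifiedDivisorMonoids.ofRlfZWeakOfProp34 (ofGaloisActionConnected A hZ)
        (prop34_ofGaloisActionConnected A hZ R R')).BΛ.obj Y)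
    (hb : b ∈ (RealifiedDivisorMonoids.ofRlfZWeakOfProp34 (ofGaloisActionConnected A hZ)
        (prop34_ofGaloisActionConnected A hZ R R')).FΛ Y) :
    ∃ b' ∈ (RealifiedDivisorMonoids.ofRlfZWeakOfProp34 (ofGaloisActionConnected A hZ)
        (prop34_ofGaloisActionConnected A hZ R R')).FΛ Y, b' * b = 1 :=
  A.exists_inv_mem_fZero Y.unop.obj b hb

/-- **`hP34Λ` (GAP G-w5d124-1; the typed field `Prop34Cnst.mem_FΛ_of_divΛ_eq_of`) is a THEOREM at this data**:
an element of `B₀^ℤ(Y)` whose image in `(Φ₀^ℝ)^gp(Y)` is (the class of) an element of `Φ₀^ℝ(Y)` is a constant.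
Route: effectivity in `(Φ₀^rlf)^gp` is detected in `Φ₀` (`RlfEffective.exists_eq_of_weak`), then Prop. 3.4 (ii)
iso 2 at the constructed data (from Prop. 3.2 (ii)). [cite: MochizukiEtTh2009, Prop 3.4 p.74] -/
theorem hP34Λ_rlfZ_ofGaloisActionConnected (Y : ((isConnectedGSet (G := G)).FullSubcategory)ᵒᵖ)
    (b : (RealifiedDivisorMonoids.ofRlfZWeakOfProp34 (ofGaloisActionConnected A hZ)
        (prop34_ofGaloisActionConnected A hZ R R')).BΛ.obj Y)
    (x : (RealifiedDivisorMonoids.ofRlfZWeakOfProp34 (ofGaloisActionConnected A hZ)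
        (prop34_ofGaloisActionConnected A hZ R R')).ΦR.obj Y)
    (hbx : (RealifiedDivisorMonoids.ofRlfZWeakOfProp34 (ofGaloisActionConnected A hZ)
        (prop34_ofGaloisActionConnected A hZ R R')).divΛ Y b = Algebra.GrothendieckGroup.of x) :
    b ∈ (RealifiedDivisorMonoids.ofRlfZWeakOfProp34 (ofGaloisActionConnected A hZ)
        (prop34_ofGaloisActionConnected A hZ R R')).FΛ Y := by
  obtain ⟨x₀, hx₀, -⟩ := RlfEffective.exists_eq_of_weak
    ((prop34_ofGaloisActionConnected A hZ R R').isPerfFactorial Y).weak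
    ((ofGaloisActionConnected A hZ).div₀ Y b) x hbx
  exact mem_fZero_of_divZeroHom_eq_of A Y.unop.obj (x := x₀) hx₀

/-- Likewise "trivial `Λ`-divisor ⇒ UNIT constant" (Prop. 3.4 (ii) iso 1 at the `Λ = ℤ` level): an element of
`B₀^ℤ(Y)` with trivial image in `(Φ₀^ℝ)^gp(Y)` has unit integral constant values.
[cite: MochizukiEtTh2009, Prop 3.4 p.74] -/
theorem ker_divΛ_rlfZ_ofGaloisActionConnected (Y : ((isConnectedGSet (G := G)).FullSubcategory)ᵒᵖ)
    (b : (RealifiedDivisorMonoids.ofRlfZWeakOfProp34 (ofGaloisActionConnected A hZ)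
        (prop34_ofGaloisActionConnected A hZ R R')).BΛ.obj Y)
    (hb : (RealifiedDivisorMonoids.ofRlfZWeakOfProp34 (ofGaloisActionConnected A hZ)
        (prop34_ofGaloisActionConnected A hZ R R')).divΛ Y b = 1) :
    ∀ s, b.1 s ∈ Z.intConst ∧ (b.1 s)⁻¹ ∈ Z.intConst := by
  have h1 : (RealifiedDivisorMonoids.ofRlfZWeakOfProp34 (ofGaloisActionConnected A hZ)
      (prop34_ofGaloisActionConnected A hZ R R')).divΛ Y b = Algebra.GrothendieckGroup.of 1 := by
    rw [hb, map_one]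
  obtain ⟨x₀, hx₀, hx₁⟩ := RlfEffective.exists_eq_of_weak
    ((prop34_ofGaloisActionConnected A hZ R R').isPerfFactorial Y).weak
    ((ofGaloisActionConnected A hZ).div₀ Y b) 1 h1
  -- `x₀ = 1` since `Φ₀ → Φ₀^rlf` is injective on the integral `Φ₀(Y)`: use the multiplicity description instead —
  -- `div₀ b = [x₀]` with `ι x₀ = 1` forces `div₀ b` trivial via `divZeroHom_eq_one_iff`
  have hdiv : A.divZeroHom Y.unop.obj b = Algebra.GrothendieckGroup.of x₀ := hx₀
  have hP := ((prop34_ofGaloisActionConnected A hZ R R').isPerfFactorial Y).weak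
  have hx₀1 : x₀ = 1 := by
    -- `Φ₀(Y) → Φ₀(Y)^pf → Φ₀(Y)^rlf` is injective (divisorial monoid; factorization homomorphism injective)
    have h2 : Perfection.of _ x₀ = 1 :=
      (fun a b (h : hP.toRealification a = hP.toRealification b) => hP.factorMap_injective (congrArg Subtype.val h))
        _ _ (by rw [map_one]; exact hx₁.symm)
    exact of_injective_of_isSharp_isIntegral_isSaturated hP.isDivisorial.isSharp
      hP.isDivisorial.isPreDivisorial.isIntegral hP.isDivisorial.isPreDivisorial.isSaturated (by rw [h2, map_one])
  rw [hx₀1, map_one] at hdiv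
  exact (A.divZeroHom_eq_one_iff Y.unop.obj b).1 hdiv

/-- **`hInt` (residual of GAP G-w5d124-2: "`Φ₀^ℝ(Y)` is integral, i.e. cancellative") is a THEOREM at this
data**: `Φ₀^ℝ(Y) = Φ₀(Y)^rlf` (weak realification) is an integral monoid (abc-iut-L2-d2's
`IsPerfFactorialWeak.Rlf.isIntegral`).  (Append 2026-08-26, same seat; prefix byte-identical.)
[cite: MochizukiEtTh2009, Def 3.6 p.76] -/
theorem hInt_rlfZ_ofGaloisActionConnected (Y : ((isConnectedGSet (G := G)).FullSubcategory)ᵒᵖ) :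
    IsCancelMul ((RealifiedDivisorMonoids.ofRlfZWeakOfProp34 (ofGaloisActionConnected A hZ)
        (prop34_ofGaloisActionConnected A hZ R R')).ΦR.obj Y) :=
  isIntegral_iff_isCancelMul.mp
    (IsPerfFactorialWeak.Rlf.isIntegral ((prop34_ofGaloisActionConnected A hZ R R').isPerfFactorial Y).weak)

end DivisorMonoids

end Literature.AnabelianGeometry.EtaleTheta

end
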